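import Summits.Ventures.CertifiedManyBodySolver.Theses.R2cOpenStripTangentLine
import Summits.Ventures.CertifiedManyBodySolver.Theorems.R2cGcTangentConsumer

/-!
# Route `R2cOpenStripTangentLine` — the GRAND-CANONICAL (`μ = 8/5`) TANGENT-LINE CONSUMER, part II (the route's
numbers) for the cruxes `RightFamilyBelowLine` (stmt-Ventures-19262) and `LeftFamilyBelowLine` (stmt-Ventures-19263)

HONEST FRAMING: first certified bounds; not a superconductivity verdict; every number certified or labelled float.
NO NUMBER IS CLAIMED HERE: every leaf-valued theorem below is an implication from the data + sentence a producer's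
certificate would assert. Candidate written by the route pen (sr-mbsolver-var-7 g16); part I (the model-general
consumer `energyDensityTT'_le_of_gcFamily_right` / `_left`) is `Theorems/R2cGcTangentConsumer.lean`.

* `gcConsumerRight_proof` / `gcConsumerLeft_proof` — the specialisations `(t,t',U) = (1,0,8)`, `μ = 8/5`, `ρ = 7/8`,
  `c = -18/25` (`c - μρ = -53/25`), stated as the pen's typed rev-4 Props `GcConsumerRight` / `GcConsumerLeft`
  UNFOLDED, and `m3Upper_tp0_le_m18o25_of_gcFamilies` — both GC families ⇒ the rung leaf (supporting line at `7/8`,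
  case split on its slope `s ≶ 8/5`).
* `m3Upper_tp0_le_m18o25_of_gcDefectFamilies` — the TURNKEY form for ONE number-indefinite object per side whose mean
  density is pinned to `7/8` up to a k-INDEPENDENT defect `q` (e.g. a `U(1)`-symmetric uniform tensor-network column with
  exact cell charge `7/8·ab` and bounded boundary charge): `|Σ_l⟨ψ_l, N̂ ψ_l⟩ - (7/8)·abk·S| ≤ q·S` on one object gives BOTH
  one-sided bounds (`M = 7/8·ab ∓ q`, `Γ = ±q`).
* `exists_unit_groundState_openBox`, `exactRightGivesGc_proof`, `exactLeftGivesGc_proof` — the rev-3 exact-filling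
  families EMBED into the GC families (`ψ` = a sector ground state, `m = 1`, `M = N`, `Γ = 0`, `E ↦ E - (8/5)N`), so the
  GC cruxes are WEAKER statements than the rev-3 cruxes; the rev-3 deciding theorem is re-derived through the GC
  consumer as `m3Upper_tp0_le_m18o25_of_gcFamilies (exactRightGivesGc_proof hR) (exactLeftGivesGc_proof hL)`
  (consistency check; that statement is already landed as `m3Upper_tp0_le_m18o25_of_families` in
  `Theorems/R2cFamilyBelowLineClosures.lean`, so it is not re-declared here).

Sources: Ruelle, *Statistical Mechanics* (1969) §2.4, §3.3–3.4 [Ruelle1969]; LeBlanc et al., Phys. Rev. X 5 (2015)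
041041, eq. (1) [LeBlancEtAl2015].
-/

noncomputable section

open Matrix Finset
open scoped ComplexOrder BigOperators

namespace Summit.Ventures.CertifiedManyBodySolver.Theorems

open Literature.MathematicalPhysics.QuantumLattice
open Literature.MathematicalPhysics.QuantumLattice.ThermodynamicLimit
open Summit.Ventures.CertifiedManyBodySolver.Theses.R2cOpenStripTangentLine

/-! ### §4 The route's numbers: `(t,t',U) = (1,0,8)`, `μ = 8/5`, `ρ = 7/8`, `c = -18/25`, `c - μρ = -53/25` -/

/-- **`GcConsumerRight`** (the pen's typed rev-4 support statement, unfolded): a RIGHT grand-canonical all-`k`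
family below `-53/25` per site for `H - (8/5)N̂` with mean density endpoint `≥ 7/8` forces the leaf value for every
supporting slope `s ≥ 8/5` at `7/8`. [cite: Ruelle1969, §3.4] -/
theorem gcConsumerRight_proof :
    (∃ a b : ℕ, ∃ E Δ M Γ : ℚ, 1 ≤ a ∧ 1 ≤ b ∧
      (E + Δ) / ((a : ℚ) * (b : ℚ)) ≤ -53 / 25 ∧
      (7 / 8 : ℚ) * ((a : ℚ) * (b : ℚ)) ≤ M + Γ ∧
      ∀ k : ℕ, 1 ≤ k → ∃ m : ℕ, ∃ ψ : Fin m → Fock (Orb (Fin a ×ₗ Fin (k * b))),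
        0 < ∑ l, (star (ψ l) ⬝ᵥ ψ l).re ∧
        ∑ l, (star (ψ l) ⬝ᵥ (hubbardOpenBoxTT' a (k * b) 1 0 8 *ᵥ ψ l)).re
            - (8 / 5 : ℝ) * ∑ l, (star (ψ l) ⬝ᵥ (totalNumber *ᵥ ψ l)).re
          ≤ (((k : ℚ) * E + ((k : ℚ) - 1) * Δ : ℚ) : ℝ) * ∑ l, (star (ψ l) ⬝ᵥ ψ l).re ∧
        (((k : ℚ) * M + ((k : ℚ) - 1) * Γ : ℚ) : ℝ) * ∑ l, (star (ψ l) ⬝ᵥ ψ l).re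
          ≤ ∑ l, (star (ψ l) ⬝ᵥ (totalNumber *ᵥ ψ l)).re) →
    ∀ s : ℝ, 8 / 5 ≤ s →
      (∀ x ∈ Set.Ico (0 : ℝ) 2,
        energyDensityTT' 1 0 8 (7 / 8) + s * (x - 7 / 8) ≤ energyDensityTT' 1 0 8 x) →
      energyDensityTT' 1 0 8 (7 / 8) ≤ -18 / 25 := by
  rintro ⟨a, b, E, Δ, M, Γ, ha, hb, hE, hM, hfam⟩ s hμs hs
  have hab : (0 : ℚ) < (a : ℚ) * (b : ℚ) := by exact_mod_cast Nat.mul_pos ha hb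
  rw [div_le_iff₀ hab] at hE
  have hE' : ((E + Δ : ℚ) : ℝ) ≤ ((-53 / 25 * ((a : ℚ) * (b : ℚ)) : ℚ) : ℝ) := by exact_mod_cast hE
  have hM' : (((7 / 8 : ℚ) * ((a : ℚ) * (b : ℚ)) : ℚ) : ℝ) ≤ ((M + Γ : ℚ) : ℝ) := by exact_mod_cast hM
  push_cast at hE' hM'
  refine energyDensityTT'_le_of_gcFamily_right 1 0 (U := 8) (by norm_num) (8 / 5) (-18 / 25) hμs hs ha hb
    (E := (E : ℝ)) (Δ := (Δ : ℝ)) (M := (M : ℝ)) (Γ := (Γ : ℝ)) (by linarith) (by linarith) fun k hk => ?_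
  obtain ⟨m, ψ, hS, hH, hN⟩ := hfam k hk
  refine ⟨m, ψ, hS, ?_, ?_⟩
  · push_cast at hH; exact hH
  · push_cast at hN; exact hN

/-- **`GcConsumerLeft`** (the pen's typed rev-4 support statement, unfolded): the LEFT family (mean density endpoint
`≤ 7/8`, mean number bounded above) forces the leaf value for every supporting slope `s ≤ 8/5`.
[cite: Ruelle1969, §3.4] -/
theorem gcConsumerLeft_proof :
    (∃ a b : ℕ, ∃ E Δ M Γ : ℚ, 1 ≤ a ∧ 1 ≤ b ∧
      (E + Δ) / ((a : ℚ) * (b : ℚ)) ≤ -53 / 25 ∧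
      M + Γ ≤ (7 / 8 : ℚ) * ((a : ℚ) * (b : ℚ)) ∧
      ∀ k : ℕ, 1 ≤ k → ∃ m : ℕ, ∃ ψ : Fin m → Fock (Orb (Fin a ×ₗ Fin (k * b))),
        0 < ∑ l, (star (ψ l) ⬝ᵥ ψ l).re ∧
        ∑ l, (star (ψ l) ⬝ᵥ (hubbardOpenBoxTT' a (k * b) 1 0 8 *ᵥ ψ l)).re
            - (8 / 5 : ℝ) * ∑ l, (star (ψ l) ⬝ᵥ (totalNumber *ᵥ ψ l)).re
          ≤ (((k : ℚ) * E + ((k : ℚ) - 1) * Δ : ℚ) : ℝ) * ∑ l, (star (ψ l) ⬝ᵥ ψ l).re ∧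
        ∑ l, (star (ψ l) ⬝ᵥ (totalNumber *ᵥ ψ l)).re
          ≤ (((k : ℚ) * M + ((k : ℚ) - 1) * Γ : ℚ) : ℝ) * ∑ l, (star (ψ l) ⬝ᵥ ψ l).re) →
    ∀ s : ℝ, s ≤ 8 / 5 →
      (∀ x ∈ Set.Ico (0 : ℝ) 2,
        energyDensityTT' 1 0 8 (7 / 8) + s * (x - 7 / 8) ≤ energyDensityTT' 1 0 8 x) →
      energyDensityTT' 1 0 8 (7 / 8) ≤ -18 / 25 := by
  rintro ⟨a, b, E, Δ, M, Γ, ha, hb, hE, hM, hfam⟩ s hsμ hs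
  have hab : (0 : ℚ) < (a : ℚ) * (b : ℚ) := by exact_mod_cast Nat.mul_pos ha hb
  rw [div_le_iff₀ hab] at hE
  have hE' : ((E + Δ : ℚ) : ℝ) ≤ ((-53 / 25 * ((a : ℚ) * (b : ℚ)) : ℚ) : ℝ) := by exact_mod_cast hE
  have hM' : ((M + Γ : ℚ) : ℝ) ≤ (((7 / 8 : ℚ) * ((a : ℚ) * (b : ℚ)) : ℚ) : ℝ) := by exact_mod_cast hM
  push_cast at hE' hM'
  refine energyDensityTT'_le_of_gcFamily_left 1 0 (U := 8) (by norm_num) (8 / 5) (-18 / 25) hsμ hs ha hb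
    (E := (E : ℝ)) (Δ := (Δ : ℝ)) (M := (M : ℝ)) (Γ := (Γ : ℝ)) (by linarith) (by linarith) fun k hk => ?_
  obtain ⟨m, ψ, hS, hH, hN⟩ := hfam k hk
  refine ⟨m, ψ, hS, ?_, ?_⟩
  · push_cast at hH; exact hH
  · push_cast at hN; exact hN

/-- **Both GC families ⇒ the rung leaf** (`Summit.Ventures.CertifiedManyBodySolver.MbsolverRungLeaves.M3Upper_tp0_le_m18o25`,
`e(1,0,8,7/8) ≤ -18/25`): take a supporting line of the convex `e(1,0,8,·)` at `7/8`
(`exists_supporting_line_energyDensityTT'`) and split on its slope `s ≶ 8/5`. This is the rev-4 deciding theorem of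
the route with the two GC cruxes UNFOLDED. [cite: Ruelle1969, §3.4] -/
theorem m3Upper_tp0_le_m18o25_of_gcFamilies
    (hR : ∃ a b : ℕ, ∃ E Δ M Γ : ℚ, 1 ≤ a ∧ 1 ≤ b ∧
      (E + Δ) / ((a : ℚ) * (b : ℚ)) ≤ -53 / 25 ∧
      (7 / 8 : ℚ) * ((a : ℚ) * (b : ℚ)) ≤ M + Γ ∧
      ∀ k : ℕ, 1 ≤ k → ∃ m : ℕ, ∃ ψ : Fin m → Fock (Orb (Fin a ×ₗ Fin (k * b))),
        0 < ∑ l, (star (ψ l) ⬝ᵥ ψ l).re ∧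
        ∑ l, (star (ψ l) ⬝ᵥ (hubbardOpenBoxTT' a (k * b) 1 0 8 *ᵥ ψ l)).re
            - (8 / 5 : ℝ) * ∑ l, (star (ψ l) ⬝ᵥ (totalNumber *ᵥ ψ l)).re
          ≤ (((k : ℚ) * E + ((k : ℚ) - 1) * Δ : ℚ) : ℝ) * ∑ l, (star (ψ l) ⬝ᵥ ψ l).re ∧
        (((k : ℚ) * M + ((k : ℚ) - 1) * Γ : ℚ) : ℝ) * ∑ l, (star (ψ l) ⬝ᵥ ψ l).re
          ≤ ∑ l, (star (ψ l) ⬝ᵥ (totalNumber *ᵥ ψ l)).re)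
    (hL : ∃ a b : ℕ, ∃ E Δ M Γ : ℚ, 1 ≤ a ∧ 1 ≤ b ∧
      (E + Δ) / ((a : ℚ) * (b : ℚ)) ≤ -53 / 25 ∧
      M + Γ ≤ (7 / 8 : ℚ) * ((a : ℚ) * (b : ℚ)) ∧
      ∀ k : ℕ, 1 ≤ k → ∃ m : ℕ, ∃ ψ : Fin m → Fock (Orb (Fin a ×ₗ Fin (k * b))),
        0 < ∑ l, (star (ψ l) ⬝ᵥ ψ l).re ∧
        ∑ l, (star (ψ l) ⬝ᵥ (hubbardOpenBoxTT' a (k * b) 1 0 8 *ᵥ ψ l)).re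
            - (8 / 5 : ℝ) * ∑ l, (star (ψ l) ⬝ᵥ (totalNumber *ᵥ ψ l)).re
          ≤ (((k : ℚ) * E + ((k : ℚ) - 1) * Δ : ℚ) : ℝ) * ∑ l, (star (ψ l) ⬝ᵥ ψ l).re ∧
        ∑ l, (star (ψ l) ⬝ᵥ (totalNumber *ᵥ ψ l)).re
          ≤ (((k : ℚ) * M + ((k : ℚ) - 1) * Γ : ℚ) : ℝ) * ∑ l, (star (ψ l) ⬝ᵥ ψ l).re) :
    Summit.Ventures.CertifiedManyBodySolver.MbsolverRungLeaves.M3Upper_tp0_le_m18o25 := by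
  obtain ⟨s, hs⟩ := exists_supporting_line_energyDensityTT' 1 0 (U := 8) (by norm_num) (ρ := 7 / 8)
    (by norm_num) (by norm_num)
  have hleaf : energyDensityTT' 1 0 8 (7 / 8) ≤ -18 / 25 := by
    rcases le_total (8 / 5 : ℝ) s with h | h
    · exact gcConsumerRight_proof hR s h hs
    · exact gcConsumerLeft_proof hL s h hs
  refine ⟨-18 / 25, le_rfl, ?_⟩
  show energyDensityTT' 1 0 8 (7 / 8) ≤ (((-18 / 25 : ℚ)) : ℝ)
  push_cast
  linarith [hleaf]

/-- **TURNKEY form for ONE number-indefinite object per side with mean density pinned to `7/8` up to a k-free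
defect.** RIGHT/LEFT data: an open box `a × b`, rationals `E, Δ, q` with `(E + Δ)/(ab) ≤ -53/25`, and for every `k ≥ 1`
a finite vector family on the open `a × (k·b)` cluster at `(1,0,8)` with `S > 0`,
`Σ Re⟨ψ_l, H ψ_l⟩ - (8/5) Σ⟨ψ_l, N̂ ψ_l⟩ ≤ (kE + (k-1)Δ)·S` and `(7/8)·abk·S - q·S ≤ Σ⟨ψ_l, N̂ ψ_l⟩` (RIGHT object) resp.
`Σ⟨ψ_l, N̂ ψ_l⟩ ≤ (7/8)·abk·S + q·S` (LEFT object) — e.g. ONE `U(1)`-symmetric uniform column state with exact cell charge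
`7/8·ab` and boundary charge at most `q` serves as both. Then the rung leaf holds (`M = 7/8·ab ∓ q`, `Γ = ±q`).
[cite: Ruelle1969, §3.4] -/
theorem m3Upper_tp0_le_m18o25_of_gcDefectFamilies (a b : ℕ) (E Δ q : ℚ) (ha : 1 ≤ a) (hb : 1 ≤ b)
    (hE : (E + Δ) / ((a : ℚ) * (b : ℚ)) ≤ -53 / 25)
    (hR : ∀ k : ℕ, 1 ≤ k → ∃ m : ℕ, ∃ ψ : Fin m → Fock (Orb (Fin a ×ₗ Fin (k * b))),
        0 < ∑ l, (star (ψ l) ⬝ᵥ ψ l).re ∧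
        ∑ l, (star (ψ l) ⬝ᵥ (hubbardOpenBoxTT' a (k * b) 1 0 8 *ᵥ ψ l)).re
            - (8 / 5 : ℝ) * ∑ l, (star (ψ l) ⬝ᵥ (totalNumber *ᵥ ψ l)).re
          ≤ (((k : ℚ) * E + ((k : ℚ) - 1) * Δ : ℚ) : ℝ) * ∑ l, (star (ψ l) ⬝ᵥ ψ l).re ∧
        (((7 / 8 : ℚ) * ((a : ℚ) * (b : ℚ)) * (k : ℚ) - q : ℚ) : ℝ) * ∑ l, (star (ψ l) ⬝ᵥ ψ l).re
          ≤ ∑ l, (star (ψ l) ⬝ᵥ (totalNumber *ᵥ ψ l)).re)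
    (a' b' : ℕ) (E' Δ' q' : ℚ) (ha' : 1 ≤ a') (hb' : 1 ≤ b')
    (hE' : (E' + Δ') / ((a' : ℚ) * (b' : ℚ)) ≤ -53 / 25)
    (hL : ∀ k : ℕ, 1 ≤ k → ∃ m : ℕ, ∃ ψ : Fin m → Fock (Orb (Fin a' ×ₗ Fin (k * b'))),
        0 < ∑ l, (star (ψ l) ⬝ᵥ ψ l).re ∧
        ∑ l, (star (ψ l) ⬝ᵥ (hubbardOpenBoxTT' a' (k * b') 1 0 8 *ᵥ ψ l)).re
            - (8 / 5 : ℝ) * ∑ l, (star (ψ l) ⬝ᵥ (totalNumber *ᵥ ψ l)).re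
          ≤ (((k : ℚ) * E' + ((k : ℚ) - 1) * Δ' : ℚ) : ℝ) * ∑ l, (star (ψ l) ⬝ᵥ ψ l).re ∧
        ∑ l, (star (ψ l) ⬝ᵥ (totalNumber *ᵥ ψ l)).re
          ≤ (((7 / 8 : ℚ) * ((a' : ℚ) * (b' : ℚ)) * (k : ℚ) + q' : ℚ) : ℝ) * ∑ l, (star (ψ l) ⬝ᵥ ψ l).re) :
    Summit.Ventures.CertifiedManyBodySolver.MbsolverRungLeaves.M3Upper_tp0_le_m18o25 := by
  refine m3Upper_tp0_le_m18o25_of_gcFamilies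
    ⟨a, b, E, Δ, (7 / 8 : ℚ) * ((a : ℚ) * (b : ℚ)) - q, q, ha, hb, hE, by linarith, fun k hk => ?_⟩
    ⟨a', b', E', Δ', (7 / 8 : ℚ) * ((a' : ℚ) * (b' : ℚ)) + q', -q', ha', hb', hE', by linarith, fun k hk => ?_⟩
  · obtain ⟨m, ψ, hS, hH, hN⟩ := hR k hk
    refine ⟨m, ψ, hS, hH, ?_⟩
    have : ((k : ℚ) * ((7 / 8 : ℚ) * ((a : ℚ) * (b : ℚ)) - q) + ((k : ℚ) - 1) * q : ℚ) =
        ((7 / 8 : ℚ) * ((a : ℚ) * (b : ℚ)) * (k : ℚ) - q : ℚ) := by ring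
    rw [this]; exact hN
  · obtain ⟨m, ψ, hS, hH, hN⟩ := hL k hk
    refine ⟨m, ψ, hS, hH, ?_⟩
    have : ((k : ℚ) * ((7 / 8 : ℚ) * ((a' : ℚ) * (b' : ℚ)) + q') + ((k : ℚ) - 1) * (-q') : ℚ) =
        ((7 / 8 : ℚ) * ((a' : ℚ) * (b' : ℚ)) * (k : ℚ) + q' : ℚ) := by ring
    rw [this]; exact hN

/-! ### §5 The rev-3 exact-filling families embed into the GC families -/

/-- **A normalised sector ground state of the open `t–t'` cluster exists** in every sector `N ≤ 2ac` (Hermitian,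
block diagonal in the particle number; finite dimension). [folklore] -/
theorem exists_unit_groundState_openBox (a c : ℕ) (t t' U : ℝ) {N : ℕ} (hN : N ≤ 2 * (a * c)) :
    ∃ ψ : Fock (Orb (Fin a ×ₗ Fin c)), IsNParticle N ψ ∧ star ψ ⬝ᵥ ψ = 1 ∧
      hubbardOpenBoxTT' a c t t' U *ᵥ ψ = ((groundEnergy (hubbardOpenBoxTT' a c t t' U) N : ℝ) : ℂ) • ψ := by
  classical
  set H := hubbardOpenBoxTT' a c t t' U with hH
  have hcard : N ≤ (Finset.univ : Finset (Orb (Fin a ×ₗ Fin c))).card := by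
    rw [Finset.card_univ, card_orb, card_rectSites]; exact hN
  obtain ⟨s₀, -, hs₀⟩ := Finset.exists_subset_card_eq hcard
  have hp : ∃ s : Finset (Orb (Fin a ×ₗ Fin c)), s.card = N := ⟨s₀, hs₀⟩
  have hpres : PreservesSectors H :=
    (LiebThm1.preservesSectors_hamiltonian (rectBoxGraph a c) t U).add
      (LiebThm1.preservesSectors_hamiltonian (rectBoxDiagGraph a c) t' 0)
  have hinv : ∀ s s' : Finset (Orb (Fin a ×ₗ Fin c)), ¬(s.card = N) → s'.card = N → H s s' = 0 := by
    intro s s' hs hs'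
    by_contra h
    have := hpres s s' h
    apply hs
    rw [card_eq_upPart_add_downPart, this.1, this.2, ← card_eq_upPart_add_downPart, hs']
  have hHerm : H.IsHermitian := hubbardOpenBoxTT'_isHermitian a c t t' U
  obtain ⟨⟨v, hv, hv0, hHv⟩, -⟩ := sector_groundState H hHerm
    (fun s : Finset (Orb (Fin a ×ₗ Fin c)) => s.card = N) hp hinv (nParticleSubmodule N) (fun v => Iff.rfl)
  obtain ⟨z, -, hz1⟩ := exists_smul_unit hv0
  refine ⟨z • v, Submodule.smul_mem _ z hv, hz1, ?_⟩
  rw [mulVec_smul, hHv, smul_comm,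
    groundEnergy_eq_minEnergyOn H N (nParticleSubmodule N) fun ψ => Iff.rfl]

/-- The data of one sector ground state as a one-element GC family member: norm `1`, `μ`-shifted energy
`E_open(N) - μN`, particle number exactly `N`. [folklore] -/
theorem gcMember_of_groundState {a c : ℕ} {t t' U : ℝ} {N : ℕ} {φ : Fock (Orb (Fin a ×ₗ Fin c))}
    (hφN : IsNParticle N φ) (hφ1 : star φ ⬝ᵥ φ = 1)
    (hHφ : hubbardOpenBoxTT' a c t t' U *ᵥ φ = ((groundEnergy (hubbardOpenBoxTT' a c t t' U) N : ℝ) : ℂ) • φ) :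
    (∑ l : Fin 1, (star ((fun _ => φ) l) ⬝ᵥ (fun _ => φ) l).re) = 1 ∧
    (∑ l : Fin 1, (star ((fun _ => φ) l) ⬝ᵥ (hubbardOpenBoxTT' a c t t' U *ᵥ (fun _ => φ) l)).re) =
      groundEnergy (hubbardOpenBoxTT' a c t t' U) N ∧
    (∑ l : Fin 1, (star ((fun _ => φ) l) ⬝ᵥ (totalNumber *ᵥ (fun _ : Fin 1 => φ) l)).re) = (N : ℝ) := by
  refine ⟨?_, ?_, ?_⟩
  · simp [hφ1]
  · simp only [Finset.univ_unique, Finset.sum_singleton]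
    rw [hHφ, dotProduct_smul, hφ1, smul_eq_mul, mul_one, Complex.ofReal_re]
  · simp only [Finset.univ_unique, Finset.sum_singleton]
    rw [totalNumber_mulVec_of_isNParticle hφN, dotProduct_smul, hφ1, smul_eq_mul, mul_one, Complex.natCast_re]

/-- **`ExactRightGivesGc`**: the rev-3 crux `RightFamilyBelowLine` implies the RIGHT GC family (`ψ` = a ground state of
the `kN` sector of the open `a × kb` cluster, `m = 1`, `M = N`, `Γ = 0`, `E ↦ E - (8/5)N`). [folklore] -/
theorem exactRightGivesGc_proof (h : RightFamilyBelowLine) :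
    ∃ a b : ℕ, ∃ E Δ M Γ : ℚ, 1 ≤ a ∧ 1 ≤ b ∧
      (E + Δ) / ((a : ℚ) * (b : ℚ)) ≤ -53 / 25 ∧
      (7 / 8 : ℚ) * ((a : ℚ) * (b : ℚ)) ≤ M + Γ ∧
      ∀ k : ℕ, 1 ≤ k → ∃ m : ℕ, ∃ ψ : Fin m → Fock (Orb (Fin a ×ₗ Fin (k * b))),
        0 < ∑ l, (star (ψ l) ⬝ᵥ ψ l).re ∧
        ∑ l, (star (ψ l) ⬝ᵥ (hubbardOpenBoxTT' a (k * b) 1 0 8 *ᵥ ψ l)).re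
            - (8 / 5 : ℝ) * ∑ l, (star (ψ l) ⬝ᵥ (totalNumber *ᵥ ψ l)).re
          ≤ (((k : ℚ) * E + ((k : ℚ) - 1) * Δ : ℚ) : ℝ) * ∑ l, (star (ψ l) ⬝ᵥ ψ l).re ∧
        (((k : ℚ) * M + ((k : ℚ) - 1) * Γ : ℚ) : ℝ) * ∑ l, (star (ψ l) ⬝ᵥ ψ l).re
          ≤ ∑ l, (star (ψ l) ⬝ᵥ (totalNumber *ᵥ ψ l)).re := by
  obtain ⟨a, b, N, E, Δ, ha, hb, hlo, hhi, hline, hfam⟩ := h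
  have hab : (0 : ℚ) < (a : ℚ) * (b : ℚ) := by exact_mod_cast Nat.mul_pos ha hb
  refine ⟨a, b, E - 8 / 5 * (N : ℚ), Δ, (N : ℚ), 0, ha, hb, ?_, by linarith, fun k hk => ?_⟩
  · rw [div_le_iff₀ hab] at hline ⊢
    have : (-18 / 25 + 8 / 5 * ((N : ℚ) / ((a : ℚ) * (b : ℚ)) - 7 / 8)) * ((a : ℚ) * (b : ℚ)) =
        -53 / 25 * ((a : ℚ) * (b : ℚ)) + 8 / 5 * (N : ℚ) := by
      field_simp
      ring
    rw [this] at hline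
    linarith
  · have hN1 : N ≤ a * b := by exact_mod_cast hhi
    have hkN : k * N ≤ 2 * (a * (k * b)) := by
      calc k * N ≤ k * (a * b) := Nat.mul_le_mul_left k hN1
        _ = a * (k * b) := by ring
        _ ≤ 2 * (a * (k * b)) := Nat.le_mul_of_pos_left _ two_pos
    obtain ⟨φ, hφN, hφ1, hHφ⟩ := exists_unit_groundState_openBox a (k * b) 1 0 8 hkN
    obtain ⟨hS, hH, hNum⟩ := gcMember_of_groundState hφN hφ1 hHφ
    refine ⟨1, fun _ => φ, by rw [hS]; exact one_pos, ?_, ?_⟩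
    · rw [hS, hH, hNum, mul_one]
      have := hfam k hk
      push_cast at this ⊢
      linarith
    · rw [hS, hNum, mul_one]
      push_cast
      linarith

/-- **`ExactLeftGivesGc`**: the rev-3 crux `LeftFamilyBelowLine` implies the LEFT GC family. [folklore] -/
theorem exactLeftGivesGc_proof (h : LeftFamilyBelowLine) :
    ∃ a b : ℕ, ∃ E Δ M Γ : ℚ, 1 ≤ a ∧ 1 ≤ b ∧
      (E + Δ) / ((a : ℚ) * (b : ℚ)) ≤ -53 / 25 ∧
      M + Γ ≤ (7 / 8 : ℚ) * ((a : ℚ) * (b : ℚ)) ∧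
      ∀ k : ℕ, 1 ≤ k → ∃ m : ℕ, ∃ ψ : Fin m → Fock (Orb (Fin a ×ₗ Fin (k * b))),
        0 < ∑ l, (star (ψ l) ⬝ᵥ ψ l).re ∧
        ∑ l, (star (ψ l) ⬝ᵥ (hubbardOpenBoxTT' a (k * b) 1 0 8 *ᵥ ψ l)).re
            - (8 / 5 : ℝ) * ∑ l, (star (ψ l) ⬝ᵥ (totalNumber *ᵥ ψ l)).re
          ≤ (((k : ℚ) * E + ((k : ℚ) - 1) * Δ : ℚ) : ℝ) * ∑ l, (star (ψ l) ⬝ᵥ ψ l).re ∧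
        ∑ l, (star (ψ l) ⬝ᵥ (totalNumber *ᵥ ψ l)).re
          ≤ (((k : ℚ) * M + ((k : ℚ) - 1) * Γ : ℚ) : ℝ) * ∑ l, (star (ψ l) ⬝ᵥ ψ l).re := by
  obtain ⟨a, b, N, E, Δ, ha, hb, hlo, hhi, hline, hfam⟩ := h
  have hab : (0 : ℚ) < (a : ℚ) * (b : ℚ) := by exact_mod_cast Nat.mul_pos ha hb
  refine ⟨a, b, E - 8 / 5 * (N : ℚ), Δ, (N : ℚ), 0, ha, hb, ?_, by linarith, fun k hk => ?_⟩
  · rw [div_le_iff₀ hab] at hline ⊢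
    have : (-18 / 25 + 8 / 5 * ((N : ℚ) / ((a : ℚ) * (b : ℚ)) - 7 / 8)) * ((a : ℚ) * (b : ℚ)) =
        -53 / 25 * ((a : ℚ) * (b : ℚ)) + 8 / 5 * (N : ℚ) := by
      field_simp
      ring
    rw [this] at hline
    linarith
  · have hN1 : N ≤ a * b := by
      have : (N : ℚ) ≤ (a : ℚ) * (b : ℚ) := hhi.trans (by nlinarith)
      exact_mod_cast this
    have hkN : k * N ≤ 2 * (a * (k * b)) := by
      calc k * N ≤ k * (a * b) := Nat.mul_le_mul_left k hN1
        _ = a * (k * b) := by ring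
        _ ≤ 2 * (a * (k * b)) := Nat.le_mul_of_pos_left _ two_pos
    obtain ⟨φ, hφN, hφ1, hHφ⟩ := exists_unit_groundState_openBox a (k * b) 1 0 8 hkN
    obtain ⟨hS, hH, hNum⟩ := gcMember_of_groundState hφN hφ1 hHφ
    refine ⟨1, fun _ => φ, by rw [hS]; exact one_pos, ?_, ?_⟩
    · rw [hS, hH, hNum, mul_one]
      have := hfam k hk
      push_cast at this ⊢
      linarith
    · rw [hS, hNum, mul_one]
      push_cast
      linarith

end Summit.Ventures.CertifiedManyBodySolver.Theorems

end
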